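import Summits.Ventures.PercRepro.Defs

/-!
# Grouping three-copy triples by join, median and meet

The three-copy analogue of `PairGrouping`: sorting three independent configurations edge by edge
— `u = ω₁ ⊔ ω₂ ⊔ ω₃` (join), `m = median ω₁ ω₂ ω₃` (edgewise majority), `v = ω₁ ⊓ ω₂ ⊓ ω₃`
(meet) — preserves the product weight, `w(ω₁) w(ω₂) w(ω₃) = w(u) w(m) w(v)`
(`weight_mul_weight_mul_weight_eq_sorted`: the multiset of the three Bernoulli factors at every edge
is the same), so every trilinear expression in the law regroups into a sum over the classes
`tripleClass u m v` with the weight `w(u) w(m) w(v)` pulled out: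

* `sum_weight3_mul_eq_sum_tripleClass`: `Σ_{ω₁,ω₂,ω₃} w w w · F(ω₁,ω₂,ω₃) = Σ_{u,m,v} w(u)w(m)w(v) · Σ_{class} F`;
* `prob_mul_prob_mul_prob_eq_sum_tripleClass`: `P(A)P(B)P(C) = Σ_{u,m,v} w(u)w(m)w(v) · #{triples of the class in A × B × C}`.

This is the three-copy sorting identity of the lead's C-007 reduction (INBOX 02:35Z): the cubic
C-007 defect becomes `Σ_{v ≤ m ≤ u} w(u) w(m) w(v) · Z₃(u, m, v)` with `Z₃` an integer count over the
class, and C-007 follows from Lemma C (`Z₃ ≥ 0` on every class) exactly as C-005 follows from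
Lemma B through `PairGrouping`.
-/

namespace PercRepro

open Finset

variable {E : Type*}

/-- The edgewise median (majority) of three configurations. -/
def median (a b c : Config E) : Config E := (a ⊓ b) ⊔ (a ⊓ c) ⊔ (b ⊓ c)

/-- Value of the median at an edge. -/
theorem median_apply (a b c : Config E) (e : E) :
    median a b c e = ((a e && b e) || (a e && c e) || (b e && c e)) := rfl

/-- One-edge factor: the three Bernoulli factors of `x, y, z` are those of the sorted triple
`(x ⊔ y ⊔ z, majority, x ⊓ y ⊓ z)`. -/
theorem bool_factor_mul3 (q : ℝ) (x y z : Bool) :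
    (if x then q else 1 - q) * (if y then q else 1 - q) * (if z then q else 1 - q) =
      (if (x || y || z) then q else 1 - q) *
        (if ((x && y) || (x && z) || (y && z)) then q else 1 - q) *
        (if (x && y && z) then q else 1 - q) := by
  cases x <;> cases y <;> cases z <;>
    simp only [Bool.or_true, Bool.or_false, Bool.and_true, Bool.and_false, ↓reduceIte] <;> ring

variable [Fintype E]

/-- **Sorting preserves the product weight**: `w(a) w(b) w(c) = w(a ⊔ b ⊔ c) w(median a b c) w(a ⊓ b ⊓ c)`. -/
theorem weight_mul_weight_mul_weight_eq_sorted (p : E → ℝ) (a b c : Config E) :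
    weight p a * weight p b * weight p c =
      weight p (a ⊔ b ⊔ c) * weight p (median a b c) * weight p (a ⊓ b ⊓ c) := by
  unfold weight
  rw [← Finset.prod_mul_distrib, ← Finset.prod_mul_distrib, ← Finset.prod_mul_distrib,
    ← Finset.prod_mul_distrib]
  refine Finset.prod_congr rfl fun e _ => ?_
  simp only [Pi.sup_apply, Pi.inf_apply, median_apply]
  exact bool_factor_mul3 (p e) (a e) (b e) (c e)

variable [DecidableEq E]

/-- The class of the sorted triple `(u, m, v)`: the triples with join `u`, median `m`, meet `v`. -/
def tripleClass (u m v : Config E) : Finset (Config E × Config E × Config E) :=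
  univ.filter fun x =>
    x.1 ⊔ x.2.1 ⊔ x.2.2 = u ∧ median x.1 x.2.1 x.2.2 = m ∧ x.1 ⊓ x.2.1 ⊓ x.2.2 = v

/-- Membership in a triple class. -/
theorem mem_tripleClass {u m v : Config E} {x : Config E × Config E × Config E} :
    x ∈ tripleClass u m v ↔
      x.1 ⊔ x.2.1 ⊔ x.2.2 = u ∧ median x.1 x.2.1 x.2.2 = m ∧ x.1 ⊓ x.2.1 ⊓ x.2.2 = v := by
  simp [tripleClass]

/-- Every triple of the class `(u, m, v)` has the weight `w(u) w(m) w(v)`. -/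
theorem weight3_of_mem_tripleClass (p : E → ℝ) {u m v : Config E}
    {x : Config E × Config E × Config E} (h : x ∈ tripleClass u m v) :
    weight p x.1 * weight p x.2.1 * weight p x.2.2 = weight p u * weight p m * weight p v := by
  rw [mem_tripleClass] at h
  rw [weight_mul_weight_mul_weight_eq_sorted, h.1, h.2.1, h.2.2]

/-- **The three-copy sorting identity**: a triple sum over three independent copies, grouped by
join, median and meet. -/
theorem sum_weight3_mul_eq_sum_tripleClass (p : E → ℝ) (F : Config E → Config E → Config E → ℝ) :
    ∑ a, ∑ b, ∑ c, weight p a * weight p b * weight p c * F a b c =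
      ∑ u, ∑ m, ∑ v, weight p u * weight p m * weight p v *
        ∑ x ∈ tripleClass u m v, F x.1 x.2.1 x.2.2 := by
  have hL : ∀ a, (∑ b, ∑ c, weight p a * weight p b * weight p c * F a b c) =
      ∑ y : Config E × Config E, weight p a * weight p y.1 * weight p y.2 * F a y.1 y.2 :=
    fun a => (Fintype.sum_prod_type' _).symm
  have hR : ∀ u, (∑ m, ∑ v, weight p u * weight p m * weight p v *
        ∑ x ∈ tripleClass u m v, F x.1 x.2.1 x.2.2) =
      ∑ y : Config E × Config E, weight p u * weight p y.1 * weight p y.2 *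
        ∑ x ∈ tripleClass u y.1 y.2, F x.1 x.2.1 x.2.2 :=
    fun u => (Fintype.sum_prod_type' _).symm
  simp only [hL, hR]
  rw [← Fintype.sum_prod_type' (fun a (y : Config E × Config E) =>
      weight p a * weight p y.1 * weight p y.2 * F a y.1 y.2),
    ← Fintype.sum_prod_type' (fun u (y : Config E × Config E) =>
      weight p u * weight p y.1 * weight p y.2 * ∑ x ∈ tripleClass u y.1 y.2, F x.1 x.2.1 x.2.2),
    ← Finset.sum_fiberwise (univ : Finset (Config E × Config E × Config E))
      (fun x => (x.1 ⊔ x.2.1 ⊔ x.2.2, median x.1 x.2.1 x.2.2, x.1 ⊓ x.2.1 ⊓ x.2.2))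
      (fun x => weight p x.1 * weight p x.2.1 * weight p x.2.2 * F x.1 x.2.1 x.2.2)]
  refine Finset.sum_congr rfl fun y _ => ?_
  have hcls : (univ.filter fun x : Config E × Config E × Config E =>
      (x.1 ⊔ x.2.1 ⊔ x.2.2, median x.1 x.2.1 x.2.2, x.1 ⊓ x.2.1 ⊓ x.2.2) = y) =
      tripleClass y.1 y.2.1 y.2.2 := by
    ext x
    simp [tripleClass, Prod.ext_iff]
  rw [hcls, Finset.mul_sum]
  refine Finset.sum_congr rfl fun x hx => ?_
  rw [weight3_of_mem_tripleClass p hx]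

/-! ### A triple class is the set of 3-colourings of `u ∖ v` -/

/-- Copy `i` of the triple encoded by a colouring `φ` of the varying edges `D = u ∖ v`: on top of
`v`, a DOUBLE edge (`m e = true`, open in two copies) is open in every copy except `φ e`, a SINGLE
edge (`m e = false`) is open in the copy `φ e` only. -/
def tripleCopy (v m : Config E) (D : Finset E) (φ : ↥D → Fin 3) (i : Fin 3) : Config E :=
  fun e => v e || (if h : e ∈ D then
    (if m e then decide (φ ⟨e, h⟩ ≠ i) else decide (φ ⟨e, h⟩ = i)) else false)

/-- The colouring of the varying edges read off a triple: the copy that differs from the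
majority at the edge. -/
def tripleColour (x : Config E × Config E × Config E) (D : Finset E) : ↥D → Fin 3 :=
  fun d => if median x.1 x.2.1 x.2.2 d then (if x.1 d then (if x.2.1 d then 2 else 1) else 0)
    else (if x.1 d then 0 else if x.2.1 d then 1 else 2)

/-- For `v ≤ m ≤ u`, the class of `(u, m, v)` is parametrised by the `3^{|u ∖ v|}` colourings
`φ : u ∖ v → {0, 1, 2}` (which copy is the odd one out at each varying edge): a sum over the class
is a sum over the colourings. -/
theorem sum_tripleClass_eq_sum_colourings {u m v : Config E} (hvm : v ≤ m) (hmu : m ≤ u)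
    (F : Config E → Config E → Config E → ℝ) :
    ∑ x ∈ tripleClass u m v, F x.1 x.2.1 x.2.2 =
      ∑ φ : ↥(openEdges u \ openEdges v) → Fin 3,
        F (tripleCopy v m (openEdges u \ openEdges v) φ 0)
          (tripleCopy v m (openEdges u \ openEdges v) φ 1)
          (tripleCopy v m (openEdges u \ openEdges v) φ 2) := by
  set D := openEdges u \ openEdges v with hD
  have hmemD : ∀ e, e ∈ D ↔ u e = true ∧ ¬ v e = true := fun e => by
    simp [hD, mem_openEdges]
  have hvm' := Config.le_iff.1 hvm
  have hmu' := Config.le_iff.1 hmu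
  -- outside `D` all three copies and `u, m, v` agree with `v`
  have hout : ∀ e, e ∉ D → u e = v e ∧ m e = v e := by
    intro e he
    have h1 : u e = true → v e = true := fun hu => by
      by_contra hv
      exact he ((hmemD e).2 ⟨hu, hv⟩)
    cases hu : u e
    · have hm : m e = false := by
        cases hm : m e
        · rfl
        · exact absurd (hmu' e hm) (by rw [hu]; decide)
      have hv : v e = false := by
        cases hv : v e
        · rfl
        · exact absurd (hvm' e hv) (by rw [hm]; decide)
      exact ⟨by rw [hv], by rw [hm, hv]⟩
    · have hv := h1 hu
      exact ⟨by rw [hv], by rw [hvm' e hv, hv]⟩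
  have hcopy_out : ∀ (φ : ↥D → Fin 3) (i : Fin 3) (e : E), e ∉ D → tripleCopy v m D φ i e = v e := by
    intro φ i e he
    simp [tripleCopy, he]
  -- every colouring gives a triple of the class
  have hj : ∀ φ : ↥D → Fin 3,
      (tripleCopy v m D φ 0, tripleCopy v m D φ 1, tripleCopy v m D φ 2) ∈ tripleClass u m v := by
    intro φ
    rw [mem_tripleClass]
    refine ⟨funext fun e => ?_, funext fun e => ?_, funext fun e => ?_⟩ <;>
    · by_cases he : e ∈ D
      · have hu : u e = true := ((hmemD e).1 he).1
        have hv : v e = false := by simpa using ((hmemD e).1 he).2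
        simp only [Pi.sup_apply, Pi.inf_apply, median_apply, tripleCopy, dif_pos he, hv,
          Bool.false_or, hu]
        generalize φ ⟨e, he⟩ = k
        cases hm : m e <;> fin_cases k <;> simp
      · obtain ⟨hu, hm⟩ := hout e he
        simp only [Pi.sup_apply, Pi.inf_apply, median_apply, hcopy_out φ _ e he, hu, hm]
        cases v e <;> rfl
  -- encoding the colouring of a class triple gives the triple back
  have hleft : ∀ x ∈ tripleClass u m v,
      (tripleCopy v m D (tripleColour x D) 0, tripleCopy v m D (tripleColour x D) 1,
        tripleCopy v m D (tripleColour x D) 2) = x := by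
    intro x hx
    obtain ⟨h1, h2, h3⟩ := mem_tripleClass.1 hx
    have hu : ∀ e, u e = (x.1 e || x.2.1 e || x.2.2 e) := fun e => by rw [← h1]; rfl
    have hm : ∀ e, m e = ((x.1 e && x.2.1 e) || (x.1 e && x.2.2 e) || (x.2.1 e && x.2.2 e)) :=
      fun e => by rw [← h2]; rfl
    have hv : ∀ e, v e = (x.1 e && x.2.1 e && x.2.2 e) := fun e => by rw [← h3]; rfl
    refine Prod.ext (funext fun e => ?_) (Prod.ext (funext fun e => ?_) (funext fun e => ?_)) <;>
    · have hue := hu e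
      have hme := hm e
      have hve := hv e
      by_cases he : e ∈ D
      · have hD' := (hmemD e).1 he
        rw [hue, hve] at hD'
        simp only [tripleCopy, dif_pos he, tripleColour, median_apply]
        rw [hve, hme]
        clear hu hm hv h1 h2 h3 hx hj hcopy_out hout hmemD hue hme hve
        generalize x.1 e = a at hD' ⊢
        generalize x.2.1 e = b at hD' ⊢
        generalize x.2.2 e = c at hD' ⊢
        cases a <;> cases b <;> cases c <;> simp_all
      · obtain ⟨huv, _⟩ := hout e he
        dsimp only
        rw [hcopy_out _ _ e he]
        rw [hue, hve] at huv
        rw [hve]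
        clear hu hm hv h1 h2 h3 hx hj hcopy_out hout hmemD hue hme hve
        generalize x.1 e = a at huv ⊢
        generalize x.2.1 e = b at huv ⊢
        generalize x.2.2 e = c at huv ⊢
        cases a <;> cases b <;> cases c <;> simp_all
  refine Finset.sum_nbij' (fun x => tripleColour x D)
    (fun φ => (tripleCopy v m D φ 0, tripleCopy v m D φ 1, tripleCopy v m D φ 2))
    (fun _ _ => Finset.mem_univ _) (fun φ _ => hj φ) hleft ?_ ?_
  · -- reading the colouring off the encoded triple gives it back
    intro φ _
    funext d
    have hd := d.2
    have hv : v d = false := by simpa using ((hmemD d).1 hd).2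
    simp only [tripleColour, median_apply, tripleCopy, dif_pos hd, hv, Bool.false_or]
    cases hm : m d <;> generalize φ ⟨d, hd⟩ = k <;> fin_cases k <;> simp
  · intro x hx
    have := congrArg (fun y : Config E × Config E × Config E => F y.1 y.2.1 y.2.2) (hleft x hx)
    exact this.symm

/-- The size of a triple class: `3^{|u ∖ v|}` when `v ≤ m ≤ u`. -/
theorem card_tripleClass {u m v : Config E} (hvm : v ≤ m) (hmu : m ≤ u) :
    (tripleClass u m v).card = 3 ^ (openEdges u \ openEdges v).card := by
  have h := sum_tripleClass_eq_sum_colourings hvm hmu (fun _ _ _ => (1 : ℝ))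
  simp only [Finset.sum_const, nsmul_eq_mul, mul_one, Finset.card_univ, Fintype.card_fun,
    Fintype.card_fin, Fintype.card_coe] at h
  exact_mod_cast h

open Classical in
/-- The number of triples of the class `(u, m, v)` lying in `A × B × C`. -/
noncomputable def tripleCount (u m v : Config E) (A B C : Set (Config E)) : ℕ :=
  (tripleClass u m v).filter (fun x => x.1 ∈ A ∧ x.2.1 ∈ B ∧ x.2.2 ∈ C) |>.card

open Classical in
/-- **Products of three probabilities as class counts**:
`P(A) P(B) P(C) = Σ_{u,m,v} w(u) w(m) w(v) · #{(ω₁, ω₂, ω₃) ∈ class(u, m, v) | ω₁ ∈ A, ω₂ ∈ B, ω₃ ∈ C}`. -/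
theorem prob_mul_prob_mul_prob_eq_sum_tripleClass (p : E → ℝ) (A B C : Set (Config E)) :
    prob p A * prob p B * prob p C =
      ∑ u, ∑ m, ∑ v, weight p u * weight p m * weight p v * (tripleCount u m v A B C : ℝ) := by
  have h : prob p A * prob p B * prob p C =
      ∑ a, ∑ b, ∑ c, weight p a * weight p b * weight p c *
        (if a ∈ A ∧ b ∈ B ∧ c ∈ C then 1 else 0) := by
    unfold prob
    rw [Finset.sum_mul_sum, Finset.sum_mul]
    refine Finset.sum_congr rfl fun a _ => ?_
    rw [Finset.sum_mul_sum]
    refine Finset.sum_congr rfl fun b _ => Finset.sum_congr rfl fun c _ => ?_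
    by_cases hA : a ∈ A <;> by_cases hB : b ∈ B <;> by_cases hC : c ∈ C <;>
      simp [Set.indicator, hA, hB, hC]
  rw [h, sum_weight3_mul_eq_sum_tripleClass]
  refine Finset.sum_congr rfl fun u _ => Finset.sum_congr rfl fun m _ =>
    Finset.sum_congr rfl fun v _ => ?_
  congr 1
  rw [tripleCount, Finset.card_filter]
  push_cast
  rfl

/-! ### Class-count certificates for cubic forms of the law -/

omit [Fintype E] [DecidableEq E] in
/-- The meet of three configurations lies below their median. -/
theorem inf_le_median (a b c : Config E) : a ⊓ b ⊓ c ≤ median a b c :=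
  le_sup_of_le_left (le_sup_of_le_left inf_le_left)

omit [Fintype E] [DecidableEq E] in
/-- The median of three configurations lies below their join. -/
theorem median_le_sup (a b c : Config E) : median a b c ≤ a ⊔ b ⊔ c :=
  sup_le (sup_le (inf_le_left.trans (le_sup_of_le_left le_sup_left))
    (inf_le_left.trans (le_sup_of_le_left le_sup_left)))
    (inf_le_left.trans (le_sup_of_le_left le_sup_right))

/-- The class of `(u, m, v)` is empty unless `v ≤ m ≤ u`. -/
theorem tripleClass_eq_empty_of_not_le {u m v : Config E} (h : ¬ (v ≤ m ∧ m ≤ u)) :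
    tripleClass u m v = ∅ := by
  rw [Finset.eq_empty_iff_forall_notMem]
  intro x hx
  obtain ⟨h1, h2, h3⟩ := mem_tripleClass.1 hx
  subst h1 h2 h3
  exact h ⟨inf_le_median _ _ _, median_le_sup _ _ _⟩

/-- A non-chain `(u, m, v)` carries no triple at all. -/
theorem tripleCount_eq_zero_of_not_le {u m v : Config E} (h : ¬ (v ≤ m ∧ m ≤ u))
    (A B C : Set (Config E)) : tripleCount u m v A B C = 0 := by
  simp [tripleCount, tripleClass_eq_empty_of_not_le h]

/-- **Cubic forms of the law as class sums**: a real combination of products of three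
probabilities, `Σ_i c_i · P(A_i) P(B_i) P(C_i)`, equals `Σ_{u,m,v} w(u) w(m) w(v) · Z(u, m, v)` with
the class statistic `Z(u, m, v) = Σ_i c_i · #{triples of the class in A_i × B_i × C_i}` (the lead's
`Z₃`; it vanishes off the chains `v ≤ m ≤ u`). -/
theorem sum_mul_prob3_eq_sum_tripleClass {ι : Type*} (s : Finset ι) (c : ι → ℝ)
    (A B C : ι → Set (Config E)) (p : E → ℝ) :
    ∑ i ∈ s, c i * (prob p (A i) * prob p (B i) * prob p (C i)) =
      ∑ u, ∑ m, ∑ v, weight p u * weight p m * weight p v *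
        ∑ i ∈ s, c i * (tripleCount u m v (A i) (B i) (C i) : ℝ) := by
  simp_rw [prob_mul_prob_mul_prob_eq_sum_tripleClass, Finset.mul_sum]
  rw [Finset.sum_comm]
  refine Finset.sum_congr rfl fun u _ => ?_
  rw [Finset.sum_comm]
  refine Finset.sum_congr rfl fun m _ => ?_
  rw [Finset.sum_comm]
  refine Finset.sum_congr rfl fun v _ => Finset.sum_congr rfl fun i _ => ?_
  ring

/-- **Class-count certificate ⇒ cubic inequality** (the Lemma C ⇒ C-007 shape): if the class
statistic `Σ_i c_i · #{class triples in A_i × B_i × C_i}` is nonnegative on every chain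
`v ≤ m ≤ u`, then `Σ_i c_i · P(A_i) P(B_i) P(C_i) ≥ 0` for every weight vector `p ∈ [0, 1]^E`. -/
theorem sum_mul_prob3_nonneg_of_tripleCount {ι : Type*} (s : Finset ι) (c : ι → ℝ)
    (A B C : ι → Set (Config E)) {p : E → ℝ} (hp : IsProb p)
    (h : ∀ u m v : Config E, v ≤ m → m ≤ u →
      0 ≤ ∑ i ∈ s, c i * (tripleCount u m v (A i) (B i) (C i) : ℝ)) :
    0 ≤ ∑ i ∈ s, c i * (prob p (A i) * prob p (B i) * prob p (C i)) := by
  rw [sum_mul_prob3_eq_sum_tripleClass]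
  refine Finset.sum_nonneg fun u _ => Finset.sum_nonneg fun m _ =>
    Finset.sum_nonneg fun v _ => ?_
  by_cases hc : v ≤ m ∧ m ≤ u
  · exact mul_nonneg (mul_nonneg (mul_nonneg (weight_nonneg hp u) (weight_nonneg hp m))
      (weight_nonneg hp v)) (h u m v hc.1 hc.2)
  · simp [tripleCount_eq_zero_of_not_le hc]

end PercRepro
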